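import Summits.BirchSwinnertonDyer.BirchSwinnertonDyer.Theorems.GenusKolyvaginAtTwoTorsionCellGenusDepthTorsion
import Summits.BirchSwinnertonDyer.BirchSwinnertonDyer.Theorems.GenusKolyvaginAtTwoTorsionCellGenusTrace
import HarnessLib

/-!
# LINE 49 «full_vertex» — GENUS PARITY: the algebraic core of the pen's THEOREM F10-B and the P_τ-LEMMA (memo #6 §4bis.6)

Crux R″ `RankOneTwoTorsionResidualAtTwo` (stmt-BirchSwinnertonDyer-27478) of route GenusKolyvaginAtTwo, LINE 49
«torsion_cell_full_vertex_bsdidea1» (pen bsd-idea-1).  This file hosts, as kernel-checked SUPPORT algebra for the line's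
research stubs F0aJ′ / F0bJ (their `C₁`-halves are fed by the lower bound (LOW)_k of memo #6; THEOREM F10-B is the pen's
GZ-formula-free (LOW)_2 outside the class 𝔉), the pen's HOME-only brick `line49/engine/GenusParity.lean` (sha16
cdb4c1c3f318a588; W-79: the pen may not propose) in DEF-FREE form: the brick's `tr act y` is written out as the trace
`∑ σ, σ • y` of a `DistribMulAction`, and membership in the brick's `lowSet act z` («the trace of `y` is an EVEN multiple of
`z′` up to torsion» — the conclusion of (LOW)) as the predicate `∃ a : ℤ, (∑ σ, σ • y) − (2a) • z ∈ A_tors`.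

* §1 trace algebra: `trace_add/neg/sub/zsmul/nsmul/sum`, `trace_fixed` (`Tr z′ = |G| • z′`), `trace_eigen` (`Tr g′_d = 0` for a
  non-trivially twisted generator; via `…GenusTrace.sum_units_smul_eq_zero`), `trace_mem_torsion`.
* §2 the LOW predicate is closed under `0, +, −` (`low_zero/add/neg`) hence under generation (**`low_of_mem_closure`** =
  brick `traceLow_of_generators`: THEOREM F10-B's step «`n_D = 0 ⟹ (LOW)`»); members: the fixed generator (`fixed_low`,
  `|G|` even), twisted generators (`eigen_low`), torsion (`torsion_low`), ANY element whose double lies in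
  `ℤz′ + Σ ℤg′_d + tors` — every HALF, whatever its support (**`double_low`**, `4 ∣ |G|`), an order-`4` glue class `W` with
  `4 • W = (2e) • z′ + Σ b_d • g′_d + t` (`glue_even_low`), and the PARITY LINK `coeff_of_glue_noD` (brick, verbatim): if
  `2 • W = R + m` with the half `R` supported AWAY from `D` then the `z′`-coefficient of `4 • W` is even (`glue_noD_low`).
* §3 **`pTau_lemma`** (brick, verbatim; `act : G → A →+ A` abstract) and `pTau_lemma_smul` (`DistribMulAction` form): the
  P_τ-LEMMA (Thm C′ for a general support) — if `2 • W = R + m`, `2 • R = δ • z′ + Σ_{d∈S} g d + t₁`,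
  `τR = R − Σ_{d∈S, ε d = −1} g d + e`, `m = a • z′ + Σ a_d • g d`, `τ(g d) = ε d • g d` (`ε d = ±1`), `τ² = 1`, then
  `δ • z′ + Σ_{d∈S, ε d = 1} g d + (t₁ + e) = 2 • Q` with `Q` FIXED by `τ` («`Σ_{v ∈ u ∩ Fix τ} g′_v + s_τ` is divisible by
  `2` in `E₀(F_τ)`»).

Dictionary (memo #6 §1, §4bis.6): `A = E₀(K_gen)`, `G = Gal(K_gen/K) ≅ (ℤ/2)^k` (`|G| = 4` at `k = 2`), `z = z′` (fixed),
`g d = g′_d` (`χ_d`-twisted, `χ_d ≠ 1`), halves `R_v`, glue classes `W̃`.  Pure algebra: no elliptic curve, Selmer group or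
Heegner point occurs here; the P-ADMISSIBILITY TABLE and the finite verification of F10-B are the pen's COMPUTATION and are
NOT claimed.  Everything is proved (no `sorry`, standard axioms); nothing here is a statement of the line, and NOTHING HERE
PROVES R″ or any summit — BSD is not advanced by this file alone.

## References

* [Serre1977] J.-P. Serre, *Linear Representations of Finite Groups*, GTM 42 (1977), §2.3.
* [SilvermanAEC2009] J. H. Silverman, *The Arithmetic of Elliptic Curves*, 2nd ed. (2009), VIII.§2, X.1 (Kummer theory of
  halves; complete `2`-descent).
-/

namespace Summit.BirchSwinnertonDyer.BirchSwinnertonDyer.Theorems.GenusKolyvaginAtTwo.FullVertex.GenusParity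

open BigOperators Finset
open Summit.BirchSwinnertonDyer.BirchSwinnertonDyer.Theorems.RankOneAtTwoOneDoor (mem_torsion_of_zsmul_mem_torsion)

/-! ## §1 Trace algebra for a `DistribMulAction` -/

section Trace

variable {ι G A : Type*} [Group G] [Fintype G] [AddCommGroup A] [DistribMulAction G A]

/-- `Tr (y₁ + y₂) = Tr y₁ + Tr y₂`. (Brick `tr_add`.) [cite: Serre1977, §2.3] -/
theorem trace_add (y₁ y₂ : A) : ∑ σ : G, σ • (y₁ + y₂) = ∑ σ : G, σ • y₁ + ∑ σ : G, σ • y₂ := by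
  simp only [smul_add, Finset.sum_add_distrib]

/-- `Tr (−y) = −Tr y`. (Brick `tr_neg`.) [cite: Serre1977, §2.3] -/
theorem trace_neg (y : A) : ∑ σ : G, σ • (-y) = -∑ σ : G, σ • y := by
  simp only [smul_neg, Finset.sum_neg_distrib]

/-- `Tr (y₁ − y₂) = Tr y₁ − Tr y₂`. [cite: Serre1977, §2.3] -/
theorem trace_sub (y₁ y₂ : A) : ∑ σ : G, σ • (y₁ - y₂) = ∑ σ : G, σ • y₁ - ∑ σ : G, σ • y₂ := by
  simp only [smul_sub, Finset.sum_sub_distrib]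

/-- `Tr (c • y) = c • Tr y` for `c ∈ ℤ`. (Brick `tr_zsmul`.) [cite: Serre1977, §2.3] -/
theorem trace_zsmul (c : ℤ) (y : A) : ∑ σ : G, σ • (c • y) = c • ∑ σ : G, σ • y := by
  rw [Finset.smul_sum]
  exact Finset.sum_congr rfl fun σ _ => smul_comm σ c y

/-- `Tr (n • y) = n • Tr y` for `n ∈ ℕ`. (Brick `tr_nsmul`.) [cite: Serre1977, §2.3] -/
theorem trace_nsmul (n : ℕ) (y : A) : ∑ σ : G, σ • (n • y) = n • ∑ σ : G, σ • y := by
  rw [Finset.smul_sum]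
  exact Finset.sum_congr rfl fun σ _ => smul_comm σ n y

/-- `Tr` commutes with finite sums. (Brick `tr_sum`.) [cite: Serre1977, §2.3] -/
theorem trace_sum (s : Finset ι) (f : ι → A) : ∑ σ : G, σ • (∑ i ∈ s, f i) = ∑ i ∈ s, ∑ σ : G, σ • f i := by
  simp only [Finset.smul_sum]
  rw [Finset.sum_comm]

/-- `Tr z′ = |G| • z′` for a fixed element. (Brick `tr_fixed`.) [cite: Serre1977, §2.3] -/
theorem trace_fixed (z : A) (hz : ∀ σ : G, σ • z = z) : ∑ σ : G, σ • z = Fintype.card G • z := by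
  simp [hz, Finset.card_univ]

/-- `Tr g′_d = 0` for a generator twisted by a non-trivial character. (Brick `tr_eigen`.) [cite: Serre1977, §2.3] -/
theorem trace_eigen (χ : G →* ℤˣ) (hχ : χ ≠ 1) (g : A) (hg : ∀ σ : G, σ • g = ((χ σ : ℤˣ) : ℤ) • g) :
    ∑ σ : G, σ • g = 0 := by
  simp_rw [hg]
  exact GenusTrace.sum_units_smul_eq_zero χ hχ g

/-- The trace of a torsion element is torsion. (Brick `nsmul_tr_eq_zero`, torsion-subgroup form.) [cite: Serre1977, §2.3] -/
theorem trace_mem_torsion {t : A} (ht : t ∈ AddCommGroup.torsion A) : ∑ σ : G, σ • t ∈ AddCommGroup.torsion A :=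
  AddSubgroup.sum_mem _ fun σ _ => GenusDepth.smul_mem_torsion σ ht

end Trace

/-! ## §2 The LOW predicate `∃ a, Tr y − (2a) • z′ ∈ A_tors` (the brick's `lowSet`, def-free) -/

section Low

variable {ι G A : Type*} [Group G] [Fintype G] [AddCommGroup A] [DistribMulAction G A]

/-- `0` is LOW. [cite: Serre1977, §2.3] -/
theorem low_zero (z : A) : ∃ a : ℤ, (∑ σ : G, σ • (0 : A)) - (2 * a) • z ∈ AddCommGroup.torsion A :=
  ⟨0, by rw [mul_zero, zero_smul, sub_zero, Finset.sum_eq_zero fun σ _ => smul_zero σ]; exact AddSubgroup.zero_mem _⟩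

/-- LOW is closed under addition. (Brick `lowSet.add_mem'`.) [cite: Serre1977, §2.3] -/
theorem low_add {z y₁ y₂ : A} (h₁ : ∃ a : ℤ, (∑ σ : G, σ • y₁) - (2 * a) • z ∈ AddCommGroup.torsion A)
    (h₂ : ∃ a : ℤ, (∑ σ : G, σ • y₂) - (2 * a) • z ∈ AddCommGroup.torsion A) :
    ∃ a : ℤ, (∑ σ : G, σ • (y₁ + y₂)) - (2 * a) • z ∈ AddCommGroup.torsion A := by
  obtain ⟨a₁, h₁⟩ := h₁
  obtain ⟨a₂, h₂⟩ := h₂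
  refine ⟨a₁ + a₂, ?_⟩
  have hsplit : (∑ σ : G, σ • (y₁ + y₂)) - (2 * (a₁ + a₂)) • z
      = ((∑ σ : G, σ • y₁) - (2 * a₁) • z) + ((∑ σ : G, σ • y₂) - (2 * a₂) • z) := by
    rw [trace_add, mul_add, add_smul]; abel
  rw [hsplit]
  exact AddSubgroup.add_mem _ h₁ h₂

/-- LOW is closed under negation. (Brick `lowSet.neg_mem'`.) [cite: Serre1977, §2.3] -/
theorem low_neg {z y : A} (h : ∃ a : ℤ, (∑ σ : G, σ • y) - (2 * a) • z ∈ AddCommGroup.torsion A) :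
    ∃ a : ℤ, (∑ σ : G, σ • (-y)) - (2 * a) • z ∈ AddCommGroup.torsion A := by
  obtain ⟨a, h⟩ := h
  refine ⟨-a, ?_⟩
  have hsplit : (∑ σ : G, σ • (-y)) - (2 * -a) • z = -((∑ σ : G, σ • y) - (2 * a) • z) := by
    rw [trace_neg, mul_neg, neg_smul]; abel
  rw [hsplit]
  exact AddSubgroup.neg_mem _ h

/-- **THEOREM F10-B, ALGEBRAIC CORE** («`n_D = 0 ⟹ (LOW)`», brick `traceLow_of_generators`): if `y` lies in the subgroup
generated by a set of elements each of which is LOW — `z′`, the `g′_d`, torsion, halves of any support, glue classes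
supported away from `D` (the lemmas below) — then `Tr y ∈ 2ℤ z′ + A_tors`. [cite: Serre1977, §2.3] -/
theorem low_of_mem_closure (z : A) (gens : Set A)
    (hgens : ∀ y ∈ gens, ∃ a : ℤ, (∑ σ : G, σ • y) - (2 * a) • z ∈ AddCommGroup.torsion A)
    {y : A} (hy : y ∈ AddSubgroup.closure gens) :
    ∃ a : ℤ, (∑ σ : G, σ • y) - (2 * a) • z ∈ AddCommGroup.torsion A := by
  refine AddSubgroup.closure_induction (p := fun y _ =>
    ∃ a : ℤ, (∑ σ : G, σ • y) - (2 * a) • z ∈ AddCommGroup.torsion A) ?_ ?_ ?_ ?_ hy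
  · exact fun x hx => hgens x hx
  · exact low_zero z
  · exact fun x y _ _ hx hy => low_add hx hy
  · exact fun x _ hx => low_neg hx

/-- The FIXED generator `z′` is LOW when `|G|` is even (`Tr z′ = |G| • z′ = 2 • (|G|/2) • z′`; brick `fixed_mem_lowSet` at
`|G| = 4`). [cite: Serre1977, §2.3] -/
theorem fixed_low {m : ℕ} (hG : Fintype.card G = 2 * m) (z : A) (hz : ∀ σ : G, σ • z = z) :
    ∃ a : ℤ, (∑ σ : G, σ • z) - (2 * a) • z ∈ AddCommGroup.torsion A := by
  refine ⟨m, ?_⟩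
  rw [trace_fixed z hz, hG, ← natCast_zsmul, Nat.cast_mul, Nat.cast_ofNat, sub_self]
  exact AddSubgroup.zero_mem _

/-- A non-trivially TWISTED generator is LOW (trace `0`; brick `eigen_mem_lowSet`). [cite: Serre1977, §2.3] -/
theorem eigen_low (z : A) (χ : G →* ℤˣ) (hχ : χ ≠ 1) (g : A) (hg : ∀ σ : G, σ • g = ((χ σ : ℤˣ) : ℤ) • g) :
    ∃ a : ℤ, (∑ σ : G, σ • g) - (2 * a) • z ∈ AddCommGroup.torsion A :=
  ⟨0, by rw [trace_eigen χ hχ g hg, mul_zero, zero_smul, sub_zero]; exact AddSubgroup.zero_mem _⟩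

/-- A TORSION element is LOW (brick `torsion_mem_lowSet`). [cite: Serre1977, §2.3] -/
theorem torsion_low (z : A) {t : A} (ht : t ∈ AddCommGroup.torsion A) :
    ∃ a : ℤ, (∑ σ : G, σ • t) - (2 * a) • z ∈ AddCommGroup.torsion A :=
  ⟨0, by rw [mul_zero, zero_smul, sub_zero]; exact trace_mem_torsion ht⟩

/-- **LEVEL ≤ 1** (brick `double_mem_lowSet`): ANY element whose DOUBLE lies in `ℤ z′ + Σ ℤ g′_d + A_tors` is LOW when
`4 ∣ |G|` — in particular every half `R_v`, WHATEVER its support (`Tr R_v = 2^(k−1)[D ∈ v] z′ + torsion`).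
[cite: SilvermanAEC2009, VIII.§2] -/
theorem double_low {m : ℕ} (hG : Fintype.card G = 4 * m) (z : A) (hz : ∀ σ : G, σ • z = z)
    (χ : ι → G →* ℤˣ) (g : ι → A) (S : Finset ι) (hχ : ∀ d ∈ S, χ d ≠ 1)
    (hg : ∀ d ∈ S, ∀ σ : G, σ • g d = ((χ d σ : ℤˣ) : ℤ) • g d)
    (R : A) {t : A} (ht : t ∈ AddCommGroup.torsion A) (δ : ℤ) (b : ι → ℤ)
    (hR : (2 : ℕ) • R = δ • z + (∑ d ∈ S, b d • g d) + t) :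
    ∃ a : ℤ, (∑ σ : G, σ • R) - (2 * a) • z ∈ AddCommGroup.torsion A := by
  refine ⟨δ * m, mem_torsion_of_zsmul_mem_torsion (two_ne_zero : (2 : ℤ) ≠ 0) ?_⟩
  -- `Tr (2 • R) = (δ |G|) • z′ + Tr t`
  have htr : ∑ σ : G, σ • ((2 : ℕ) • R) = (δ * ((4 * m : ℕ) : ℤ)) • z + ∑ σ : G, σ • t := by
    rw [hR, trace_add, trace_add, trace_zsmul, trace_fixed z hz, hG, trace_sum]
    have h0 : ∑ d ∈ S, ∑ σ : G, σ • (b d • g d) = 0 :=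
      Finset.sum_eq_zero fun d hd => by rw [trace_zsmul, trace_eigen (χ d) (hχ d hd) (g d) (hg d hd), smul_zero]
    rw [h0, add_zero, ← natCast_zsmul, smul_smul]
  have key : (2 : ℤ) • ((∑ σ : G, σ • R) - (2 * (δ * m)) • z) = ∑ σ : G, σ • t := by
    rw [smul_sub, two_zsmul (∑ σ : G, σ • R), ← two_nsmul, ← trace_nsmul, htr, smul_smul]
    have hc : δ * ((4 * m : ℕ) : ℤ) = 2 * (2 * (δ * m)) := by push_cast; ring
    rw [hc]; abel
  rw [key]
  exact trace_mem_torsion ht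

/-- An order-`4` GLUE class `W` with `4 • W = (2e) • z′ + Σ b_d • g′_d + t` (EVEN `z′`-coefficient) is LOW when `4 ∣ |G|`
(brick `glue_even_mem_lowSet`). [cite: SilvermanAEC2009, VIII.§2] -/
theorem glue_even_low {m : ℕ} (hG : Fintype.card G = 4 * m) (z : A) (hz : ∀ σ : G, σ • z = z)
    (χ : ι → G →* ℤˣ) (g : ι → A) (S : Finset ι) (hχ : ∀ d ∈ S, χ d ≠ 1)
    (hg : ∀ d ∈ S, ∀ σ : G, σ • g d = ((χ d σ : ℤˣ) : ℤ) • g d)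
    (W : A) {t : A} (ht : t ∈ AddCommGroup.torsion A) (e : ℤ) (b : ι → ℤ)
    (hW : (4 : ℕ) • W = (2 * e) • z + (∑ d ∈ S, b d • g d) + t) :
    ∃ a : ℤ, (∑ σ : G, σ • W) - (2 * a) • z ∈ AddCommGroup.torsion A := by
  refine ⟨e * m, mem_torsion_of_zsmul_mem_torsion (by norm_num : (4 : ℤ) ≠ 0) ?_⟩
  have htr : ∑ σ : G, σ • ((4 : ℕ) • W) = ((2 * e) * ((4 * m : ℕ) : ℤ)) • z + ∑ σ : G, σ • t := by
    rw [hW, trace_add, trace_add, trace_zsmul, trace_fixed z hz, hG, trace_sum]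
    have h0 : ∑ d ∈ S, ∑ σ : G, σ • (b d • g d) = 0 :=
      Finset.sum_eq_zero fun d hd => by rw [trace_zsmul, trace_eigen (χ d) (hχ d hd) (g d) (hg d hd), smul_zero]
    rw [h0, add_zero, ← natCast_zsmul, smul_smul]
  have key : (4 : ℤ) • ((∑ σ : G, σ • W) - (2 * (e * m)) • z) = ∑ σ : G, σ • t := by
    rw [smul_sub, show (4 : ℤ) • (∑ σ : G, σ • W) = (4 : ℕ) • (∑ σ : G, σ • W) by
      rw [← natCast_zsmul, Nat.cast_ofNat], ← trace_nsmul, htr, smul_smul]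
    have hc : (2 * e) * ((4 * m : ℕ) : ℤ) = 4 * (2 * (e * m)) := by push_cast; ring
    rw [hc]; abel
  rw [key]
  exact trace_mem_torsion ht

omit [Group G] [Fintype G] [DistribMulAction G A] in
/-- **PARITY LINK** (memo #6 §4bis.6 (2); brick, verbatim): if `2 • W = R + m` with `R` a half supported AWAY from `D`
(`2 • R = Σ_{d∈S} b_d • g′_d + t₁`, no `z′`-term) and `m = a • z′ + Σ a_d • g′_d ∈ M′`, then
`4 • W = (2a) • z′ + Σ (b_d + 2a_d) • g′_d + t₁`: the `z′`-coefficient is EVEN. [cite: SilvermanAEC2009, VIII.§2] -/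
theorem coeff_of_glue_noD (z : A) (g : ι → A) (S : Finset ι) (W R t₁ : A) (a : ℤ) (ad b : ι → ℤ)
    (hR : (2 : ℕ) • R = (∑ d ∈ S, b d • g d) + t₁)
    (hW : (2 : ℕ) • W = R + (a • z + ∑ d ∈ S, ad d • g d)) :
    (4 : ℕ) • W = (2 * a) • z + (∑ d ∈ S, (b d + 2 * ad d) • g d) + t₁ := by
  have e1 : (∑ d ∈ S, (b d + 2 * ad d) • g d)
      = (∑ d ∈ S, b d • g d) + (2 : ℤ) • ∑ d ∈ S, ad d • g d := by
    simp only [add_smul, Finset.sum_add_distrib, mul_smul, Finset.smul_sum]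
  rw [e1]
  linear_combination (norm := module) (2 : ℤ) • hW + hR

/-- COROLLARY: a glue class supported away from `D` is LOW (`4 ∣ |G|`; brick `glue_noD_mem_lowSet`).
[cite: SilvermanAEC2009, VIII.§2] -/
theorem glue_noD_low {m : ℕ} (hG : Fintype.card G = 4 * m) (z : A) (hz : ∀ σ : G, σ • z = z)
    (χ : ι → G →* ℤˣ) (g : ι → A) (S : Finset ι) (hχ : ∀ d ∈ S, χ d ≠ 1)
    (hg : ∀ d ∈ S, ∀ σ : G, σ • g d = ((χ d σ : ℤˣ) : ℤ) • g d)
    (W R : A) {t₁ : A} (ht : t₁ ∈ AddCommGroup.torsion A) (a : ℤ) (ad b : ι → ℤ)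
    (hR : (2 : ℕ) • R = (∑ d ∈ S, b d • g d) + t₁)
    (hW : (2 : ℕ) • W = R + (a • z + ∑ d ∈ S, ad d • g d)) :
    ∃ a : ℤ, (∑ σ : G, σ • W) - (2 * a) • z ∈ AddCommGroup.torsion A :=
  glue_even_low hG z hz χ g S hχ hg W ht a (fun d => b d + 2 * ad d) (coeff_of_glue_noD z g S W R t₁ a ad b hR hW)

end Low

/-! ## §3 The P_τ-lemma (Thm C′ for a general support; memo #6 §4bis.6 (3)) -/

section PTau

variable {ι G A : Type*} [AddCommGroup A]

/-- **P_τ-LEMMA** (brick, verbatim).  Fix `τ ∈ G` with `τ² = 1` acting through a monoid action by additive maps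
`act : G → A →+ A`; `z′` fixed; `act τ (g d) = ε_d • g d` with `ε_d = ±1` on the support `S`; a half `R` with
`2 • R = δ • z′ + Σ_{d∈S} g d + t₁` and cocycle `act τ R = R − Σ_{d∈S, ε_d = −1} g d + e`; a glue class `W` with
`2 • W = R + (a • z′ + Σ_{d∈S} a_d • g d)`.  Then `δ • z′ + Σ_{d ∈ S, ε_d = 1} g d + (t₁ + e) = 2 • Q` with `act τ Q = Q`:
the partial sum over `u ∩ Fix(τ)` plus a `2`-torsion correction is divisible by `2` among the `τ`-fixed points.
[cite: SilvermanAEC2009, VIII.§2] -/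
theorem pTau_lemma [Monoid G] [DecidableEq ι] (act : G → A →+ A)
    (hmul : ∀ σ σ' (x : A), act (σ * σ') x = act σ (act σ' x))
    (hone : ∀ x : A, act 1 x = x) (τ : G) (hτ : τ * τ = 1)
    (z : A) (hz : act τ z = z) (g : ι → A) (S : Finset ι) (ε : ι → ℤ)
    (hε : ∀ d ∈ S, ε d = 1 ∨ ε d = -1) (hg : ∀ d ∈ S, act τ (g d) = ε d • g d)
    (R W t₁ e : A) (δ a : ℤ) (ad : ι → ℤ)
    (hR2 : (2 : ℕ) • R = δ • z + (∑ d ∈ S, g d) + t₁)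
    (hRτ : act τ R = R - (∑ d ∈ S.filter (fun d => ε d = -1), g d) + e)
    (hW : (2 : ℕ) • W = R + (a • z + ∑ d ∈ S, ad d • g d)) :
    ∃ Q : A, act τ Q = Q ∧
      (2 : ℕ) • Q = δ • z + (∑ d ∈ S.filter (fun d => ε d = 1), g d) + (t₁ + e) := by
  -- the τ-even part of m
  set mplus : A := a • z + ∑ d ∈ S.filter (fun d => ε d = 1), ad d • g d with hmplus
  refine ⟨W + act τ W - mplus, ?_, ?_⟩
  · -- τ-invariance
    have hττW : act τ (act τ W) = W := by rw [← hmul, hτ, hone]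
    have hτm : act τ mplus = mplus := by
      rw [hmplus, map_add, map_zsmul, hz, map_sum]
      congr 1
      refine Finset.sum_congr rfl fun d hd => ?_
      rw [Finset.mem_filter] at hd
      rw [map_zsmul, hg d hd.1, hd.2, one_smul]
    rw [map_sub, map_add, hττW, hτm]; abel
  · -- doubling
    have hsplit : ∀ f : ι → A, (∑ d ∈ S, f d)
        = (∑ d ∈ S.filter (fun d => ε d = 1), f d) + ∑ d ∈ S.filter (fun d => ε d = -1), f d := by
      intro f
      rw [← Finset.sum_filter_add_sum_filter_not S (fun d => ε d = 1)]
      congr 1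
      refine Finset.sum_congr ?_ fun _ _ => rfl
      ext d
      simp only [Finset.mem_filter, and_congr_right_iff]
      intro hd
      rcases hε d hd with h | h
      · simp [h]
      · simp [h]
    have h2W : (2 : ℕ) • act τ W = act τ R + (a • z + ∑ d ∈ S, (ad d * ε d) • g d) := by
      rw [← map_nsmul, hW, map_add, map_add, map_zsmul, hz, map_sum]
      congr 2
      refine Finset.sum_congr rfl fun d hd => ?_
      rw [map_zsmul, hg d hd, ← mul_smul]
    have hm1 : (∑ d ∈ S, (ad d * ε d) • g d)
        = (∑ d ∈ S.filter (fun d => ε d = 1), ad d • g d)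
          - ∑ d ∈ S.filter (fun d => ε d = -1), ad d • g d := by
      rw [hsplit (fun d => (ad d * ε d) • g d), sub_eq_add_neg, ← Finset.sum_neg_distrib]
      congr 1
      · refine Finset.sum_congr rfl fun d hd => ?_
        rw [Finset.mem_filter] at hd; rw [hd.2, mul_one]
      · refine Finset.sum_congr rfl fun d hd => ?_
        rw [Finset.mem_filter] at hd; rw [hd.2, mul_neg_one, neg_smul]
    have hm0 : (∑ d ∈ S, ad d • g d)
        = (∑ d ∈ S.filter (fun d => ε d = 1), ad d • g d)
          + ∑ d ∈ S.filter (fun d => ε d = -1), ad d • g d := hsplit _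
    have hg0 : (∑ d ∈ S, g d)
        = (∑ d ∈ S.filter (fun d => ε d = 1), g d)
          + ∑ d ∈ S.filter (fun d => ε d = -1), g d := hsplit _
    rw [smul_sub, smul_add, h2W, hW, hRτ, hm1, hmplus]
    -- collect: R + R = 2 • R
    have hRR : R + (a • z + ∑ d ∈ S, ad d • g d)
        + (R - (∑ d ∈ S.filter (fun d => ε d = -1), g d) + e
          + (a • z + ((∑ d ∈ S.filter (fun d => ε d = 1), ad d • g d)
            - ∑ d ∈ S.filter (fun d => ε d = -1), ad d • g d)))
        - (2 : ℕ) • (a • z + ∑ d ∈ S.filter (fun d => ε d = 1), ad d • g d)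
        = (2 : ℕ) • R - (∑ d ∈ S.filter (fun d => ε d = -1), g d) + e := by
      rw [hm0, two_nsmul, two_nsmul]; abel
    rw [hRR, hR2, hg0]; abel

/-- **P_τ-LEMMA for a `DistribMulAction`** (`act σ = (σ • ·)`): with `τ² = 1`, `τ • z′ = z′`, `τ • g d = ε_d • g d`
(`ε_d = ±1` on `S`), a half `R` (`2 • R = δ • z′ + Σ_{d∈S} g d + t₁`, `τ • R = R − Σ_{d∈S, ε_d=−1} g d + e`) and a glue class
`W` (`2 • W = R + (a • z′ + Σ a_d • g d)`), the element `δ • z′ + Σ_{d∈S, ε_d=1} g d + (t₁ + e)` is `2 • Q` for a `τ`-FIXED `Q`.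
[cite: SilvermanAEC2009, VIII.§2] -/
theorem pTau_lemma_smul [Monoid G] [DistribMulAction G A] [DecidableEq ι] (τ : G) (hτ : τ * τ = 1)
    (z : A) (hz : τ • z = z) (g : ι → A) (S : Finset ι) (ε : ι → ℤ)
    (hε : ∀ d ∈ S, ε d = 1 ∨ ε d = -1) (hg : ∀ d ∈ S, τ • g d = ε d • g d)
    (R W t₁ e : A) (δ a : ℤ) (ad : ι → ℤ)
    (hR2 : (2 : ℕ) • R = δ • z + (∑ d ∈ S, g d) + t₁)
    (hRτ : τ • R = R - (∑ d ∈ S.filter (fun d => ε d = -1), g d) + e)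
    (hW : (2 : ℕ) • W = R + (a • z + ∑ d ∈ S, ad d • g d)) :
    ∃ Q : A, τ • Q = Q ∧
      (2 : ℕ) • Q = δ • z + (∑ d ∈ S.filter (fun d => ε d = 1), g d) + (t₁ + e) :=
  pTau_lemma (fun σ => DistribSMul.toAddMonoidHom A σ) (fun σ σ' x => mul_smul σ σ' x) (fun x => one_smul G x)
    τ hτ z hz g S ε hε hg R W t₁ e δ a ad hR2 hRτ hW

end PTau

end Summit.BirchSwinnertonDyer.BirchSwinnertonDyer.Theorems.GenusKolyvaginAtTwo.FullVertex.GenusParity
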